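import Literature.AlgebraicGeometry.Resolution.AlterationsBoundarySmoothLocus
import Literature.AlgebraicGeometry.Resolution.FormalNormalCrossingsLemmas
import Mathlib.RingTheory.MvPowerSeries.Inverse
import HarnessLib

/-!
# De Jong's alteration theorem: the formal structure of a semi-stable curve at a closed point of
# `Sing(f)` over a strict normal crossings base (de Jong 1996, 2.23 and 3.3, split case)

Topic: `Literature/AlgebraicGeometry/Resolution`. The three remaining local leaves of the
decomposition of de Jong 1996, 4.24 (`DeJong1996SemiStablePairNormalForm`,
`AlterationsNormalForm.lean`) kept by the owning literature unit —
`DeJong1996SemiStableBoundaryNormalCrossingsSingF` (3.3 with `Σ nᵢ = 1`,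
`AlterationsBoundarySmoothLocus.lean`), `DeJong1996CodimThreeNodalForm` and
`DeJong1996CodimThreeSingularComponentsRegular` (3.5, `AlterationsIsNormalFormParts.lean`) — all
rest on ONE printed local statement, the description 3.3 of the complete local ring of the total
space of a semi-stable curve at a point of `Sing(f)` over a regular base with a strict normal
crossings divisor, itself the combination of the local structure of nodes 2.23 with "`Sing(f)`
lies over `D`":

> "2.23. (Local description of (split) semi-stable curves.) Let `f : X → S` be a semi-stable
> curve with `S` Noetherian. Consider a point `x ∈ Sing(f)` and let `s = f(x)`. … Let `B` be the
> complete local ring of `X` at `x` and let `A` be the complete local ring of `S` at `s`. … If `f`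
> is a split semi-stable curve, then `k = k'` and the quadratic form `q` splits over `k`. … Thus
> we may choose `q = uv` and `Q = uv`. The complete local ring of `X` at `x` is
> `B ≅ A⟦u, v⟧/(uv - h)` for some `h ∈ A`." (pp. 61–62)
>
> "3.3. Let us describe the local situation at a point `x ∈ Sing(X)`. Put `s = f(x) ∈ S`. Let
> `A → A' → B` be as in 2.23, and choose an isomorphism `B ≅ A'⟦u, v⟧/(Q - h)`, with `h ∈ A'`
> (2.23). Suppose that `s` lies in the components `D₁, …, D_r` of `D` but not in any other
> component. Let `tᵢ ∈ 𝒪_{S,s}` be an element such that `V(tᵢ) = Dᵢ ∩ Spec 𝒪_{S,s}`. Note that the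
> elements `t₁, …, t_r` form [part of] a regular system of parameters of `𝒪_{S,s}`, hence also
> of `A` and `A'`. The singular locus of `f` traced on `Spec B` maps isomorphically to the closed
> subscheme `V(h) ⊂ Spec A'`. By assumption we have `V(h) ⊂ V(t₁ ⋯ t_r)`. Therefore we see that
> `h = ε t₁^{n₁} ⋯ t_r^{n_r}`, `ε ∈ (A')^*` with `nᵢ ≥ 0` and `Σ nᵢ ≥ 2` (if `Σ nᵢ = 1`, then the
> point `x` is regular on `X`). We change `Q` into `ε⁻¹ Q`. Thus we have
> `B ≅ A'⟦u, v⟧/(Q - t₁^{n₁} ⋯ t_r^{n_r})`. … Furthermore, in the split case we may assume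
> `A = A'` and `Q(u, v) = uv`, see 2.23." (p. 63)
>
> "4.24. … (Note that there [4.25] we consider only closed points, so that the situation is
> automatically split.)" (p. 75)

(The derivation of 3.3 is carried out for every `x ∈ Sing(f)`, the hypothesis of 2.23; de Jong
applies it at the regular points of `Sing(f)` too — "if `Σ nᵢ = 1`, then the point `x` is
regular on `X`".) This file

* defines the **formal node ring** `DeJong1996.FormalNodeRing k m ν = k⟦u, v, T₁, …, T_m⟧/(uv - ∏ Tᵢ^{νᵢ})`
  (`formalNodeRelation`), of which the model `NodalFamilyRing k m s` of Situation 4.25 (ii) is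
  the case `ν = 𝟙_{i < s}` (`formalNodeRelation_indicator`, `formalNodeRingEquivNodalFamilyRing`);
* vendors the NAMED FACT `DeJong1996SplitNodalStructure` — 3.3 in the split case at a CLOSED
  point `x` of the curve `f : X → Y` of a pair in Situation 4.23 over an algebraically closed
  field `k` at which `f` is not smooth, with `A = 𝒪̂_{Y,f x} ≅ k⟦T₁, …, T_m⟧` written out by Cohen's
  structure theorem (`A` is a complete regular local ring with residue field `k ⊂ A` and regular
  system of parameters `t₁, …, t_m`): for every regular system of parameters `t₁, …, t_m` of
  `𝒪_{Y,f x}` whose first `r` members cut out `D` (`I(D)_{f x} = (t₁ ⋯ t_r)`, the local form of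
  the strict normal crossings divisor `D`, 2.4) there are exponents `νᵢ ≥ 0`, vanishing for
  `i > r`, and an isomorphism `𝒪̂_{X,x} ≅ k⟦u, v, T₁, …, T_m⟧/(uv - ∏ Tᵢ^{νᵢ})` mapping (the image
  of) `f^#(tᵢ)` to `Tᵢ`;
* PROVES the small API the users need: the relation is not a unit iff it has no constant term,
  i.e. iff `Σ νᵢ ≥ 1`, in which case the formal node ring is a nontrivial local ring whose
  maximal ideal is generated by the classes of the variables
  (`FormalNodeRing.maximalIdeal_eq_span`), and `uv = ∏ Tᵢ^{νᵢ}` in it (`FormalNodeRing.mk_X_mul_X`).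

The general statement behind it (2.23/3.3 at an arbitrary point of `Sing(f)`, non-split:
`B ≅ A'⟦u, v⟧/(Q - h)` with `A → A'` finite étale and `Q` a non-degenerate quadratic form) is the
node announced as `DeJong1996NodeLocalStructure` in `AlterationsSemiStableThickness.lean`; the
present fact is its case `A' = A`, `Q = uv` at a closed point over an algebraically closed field,
followed by Cohen's theorem for `A`.

## Sources

* A. J. de Jong, *Smoothness, semi-stability and alterations*, Publ. Math. IHÉS 83 (1996) 51–93:
  2.21–2.23 (pp. 61–62), 3.1, 3.3 (pp. 62–63), 4.24–4.25 (p. 75).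
* H. Matsumura, *Commutative Ring Theory* (1986), Thm. 29.7 (Cohen: a complete regular local
  ring containing a field is a formal power series ring over its residue field).
-/

noncomputable section

open CategoryTheory CategoryTheory.Limits AlgebraicGeometry TopologicalSpace Topology
  IsLocalRing

namespace Literature.AlgebraicGeometry.Resolution

universe u

open Scheme.IdealSheafData

/-! ## The formal node ring `k⟦u, v, T₁, …, T_m⟧/(uv - ∏ Tᵢ^{νᵢ})` -/

namespace DeJong1996

/-- The relation `uv - T₁^{ν₁} ⋯ T_m^{ν_m}` of 3.3 in `k⟦u, v, T₁, …, T_m⟧ =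
MvPowerSeries (Fin 2 ⊕ Fin m) k` (`u = inl 0`, `v = inl 1`, `Tᵢ = inr (i - 1)`), for an exponent
vector `ν`. [cite: DeJong1996, 3.3, p. 63] -/
def formalNodeRelation (k : Type u) [Field k] (m : ℕ) (ν : Fin m → ℕ) :
    MvPowerSeries (Fin 2 ⊕ Fin m) k :=
  MvPowerSeries.X (Sum.inl 0) * MvPowerSeries.X (Sum.inl 1) -
    ∏ i, MvPowerSeries.X (Sum.inr i) ^ (ν i)

/-- The **formal node ring** `k⟦u, v, T₁, …, T_m⟧/(uv - T₁^{ν₁} ⋯ T_m^{ν_m})`, the complete local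
ring `A⟦u, v⟧/(uv - t₁^{n₁} ⋯ t_r^{n_r})` of 3.3 (split case) with `A = k⟦T₁, …, T_m⟧`.
[cite: DeJong1996, 3.3, p. 63] -/
abbrev FormalNodeRing (k : Type u) [Field k] (m : ℕ) (ν : Fin m → ℕ) : Type u :=
  MvPowerSeries (Fin 2 ⊕ Fin m) k ⧸ Ideal.span {formalNodeRelation k m ν}

/-- For the indicator exponents `νᵢ = 1 (i < s), 0 (i ≥ s)` the relation of 3.3 is the relation
`uv - T₁ ⋯ T_s` of Situation 4.25 (ii) (`nodalFamilyRelation`). [cite: DeJong1996, 3.5, p. 64] -/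
theorem formalNodeRelation_indicator (k : Type u) [Field k] (m s : ℕ) :
    formalNodeRelation k m (fun i => if i.val < s then 1 else 0) = nodalFamilyRelation k m s := by
  unfold formalNodeRelation nodalFamilyRelation
  congr 1
  rw [Finset.prod_filter]
  refine Finset.prod_congr rfl fun i _ => ?_
  dsimp only
  by_cases h : i.val < s
  · rw [if_pos h, if_pos h, pow_one]
  · rw [if_neg h, if_neg h, pow_zero]

/-- Accordingly the formal node ring with indicator exponents is the model ring
`NodalFamilyRing k m s` of Situation 4.25 (ii), by an isomorphism fixing the classes of all
power series. [cite: DeJong1996, 3.5 and 4.25 (ii), pp. 64, 75] -/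
def formalNodeRingEquivNodalFamilyRing (k : Type u) [Field k] (m s : ℕ) :
    FormalNodeRing k m (fun i => if i.val < s then 1 else 0) ≃+* NodalFamilyRing k m s :=
  Ideal.quotEquivOfEq (by rw [formalNodeRelation_indicator])

/-- `formalNodeRingEquivNodalFamilyRing` fixes the classes of power series. [folklore] -/
@[simp]
theorem formalNodeRingEquivNodalFamilyRing_mk (k : Type u) [Field k] (m s : ℕ)
    (φ : MvPowerSeries (Fin 2 ⊕ Fin m) k) :
    formalNodeRingEquivNodalFamilyRing k m s (Ideal.Quotient.mk _ φ) = Ideal.Quotient.mk _ φ :=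
  rfl

namespace FormalNodeRing

variable (k : Type u) [Field k] (m : ℕ) (ν : Fin m → ℕ)

/-- `uv = ∏ Tᵢ^{νᵢ}` in the formal node ring. [cite: DeJong1996, 3.3, p. 63] -/
theorem mk_X_mul_X :
    Ideal.Quotient.mk (Ideal.span {formalNodeRelation k m ν}) (MvPowerSeries.X (Sum.inl 0)) *
        Ideal.Quotient.mk (Ideal.span {formalNodeRelation k m ν}) (MvPowerSeries.X (Sum.inl 1)) =
      Ideal.Quotient.mk (Ideal.span {formalNodeRelation k m ν})
        (∏ i, MvPowerSeries.X (Sum.inr i) ^ (ν i)) := by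
  rw [← map_mul, Ideal.Quotient.mk_eq_mk_iff_sub_mem]
  exact Ideal.subset_span rfl

/-- The constant coefficient of the relation `uv - ∏ Tᵢ^{νᵢ}` is `-1` if all `νᵢ = 0` and `0`
otherwise. [folklore] -/
theorem constantCoeff_formalNodeRelation :
    MvPowerSeries.constantCoeff (formalNodeRelation k m ν) = if ∀ i, ν i = 0 then -1 else 0 := by
  unfold formalNodeRelation
  simp only [map_sub, map_mul, MvPowerSeries.constantCoeff_X, mul_zero, zero_sub, map_prod,
    map_pow]
  split_ifs with h
  · simp [h]
  · push Not at h
    obtain ⟨i, hi⟩ := h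
    rw [Finset.prod_eq_zero (Finset.mem_univ i) (by rw [zero_pow hi]), neg_zero]

/-- The relation `uv - ∏ Tᵢ^{νᵢ}` lies in the maximal ideal of `k⟦u, v, T⟧` iff some `νᵢ ≥ 1`
(for `ν = 0` it is the unit `uv - 1`). [folklore] -/
theorem formalNodeRelation_mem_maximalIdeal_iff :
    formalNodeRelation k m ν ∈ maximalIdeal (MvPowerSeries (Fin 2 ⊕ Fin m) k) ↔ ∃ i, ν i ≠ 0 := by
  rw [mem_maximalIdeal, mem_nonunits_iff, MvPowerSeries.isUnit_iff_constantCoeff,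
    constantCoeff_formalNodeRelation]
  split_ifs with h
  · constructor
    · intro h1
      exact (h1 isUnit_neg_one).elim
    · rintro ⟨i, hi⟩
      exact (hi (h i)).elim
  · push Not at h
    exact ⟨fun _ => h, fun _ => not_isUnit_zero⟩

variable {ν}

/-- If some `νᵢ ≥ 1`, the formal node ring is nontrivial. [folklore] -/
theorem nontrivial (hν : ∃ i, ν i ≠ 0) : Nontrivial (FormalNodeRing k m ν) := by
  refine Ideal.Quotient.nontrivial_iff.mpr ?_
  intro htop
  have hmem := (formalNodeRelation_mem_maximalIdeal_iff k m ν).mpr hν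
  have hle : Ideal.span {formalNodeRelation k m ν} ≤ maximalIdeal _ :=
    (Ideal.span_singleton_le_iff_mem _).mpr hmem
  rw [htop, top_le_iff] at hle
  exact (maximalIdeal.isMaximal _).ne_top hle

/-- If some `νᵢ ≥ 1`, the formal node ring is a local ring (a quotient of the local ring
`k⟦u, v, T⟧` by a proper ideal). [folklore] -/
theorem isLocalRing (hν : ∃ i, ν i ≠ 0) : IsLocalRing (FormalNodeRing k m ν) :=
  haveI := nontrivial k m hν
  IsLocalRing.of_surjective' (Ideal.Quotient.mk _) Ideal.Quotient.mk_surjective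

/-- If some `νᵢ ≥ 1`, the maximal ideal of the formal node ring is generated by the classes of
the variables `u, v, T₁, …, T_m`. [folklore] -/
theorem maximalIdeal_eq_span (hν : ∃ i, ν i ≠ 0) :
    haveI := isLocalRing k m hν
    maximalIdeal (FormalNodeRing k m ν) =
      Ideal.span (Set.range fun j : Fin 2 ⊕ Fin m =>
        Ideal.Quotient.mk (Ideal.span {formalNodeRelation k m ν}) (MvPowerSeries.X j)) := by
  haveI := nontrivial k m hν
  haveI := isLocalRing k m hν
  have hsurj : Function.Surjective (Ideal.Quotient.mk (Ideal.span {formalNodeRelation k m ν})) :=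
    Ideal.Quotient.mk_surjective
  haveI := IsLocalHom.of_surjective _ hsurj
  have h := IsLocalRing.maximalIdeal_comap
    (Ideal.Quotient.mk (Ideal.span {formalNodeRelation k m ν}))
  -- `𝔪 = map mk 𝔪_{k⟦u,v,T⟧}` for the surjective local map `mk`
  have hmap : maximalIdeal (FormalNodeRing k m ν) =
      (maximalIdeal (MvPowerSeries (Fin 2 ⊕ Fin m) k)).map (Ideal.Quotient.mk _) := by
    refine le_antisymm ?_ ?_
    · intro a ha
      obtain ⟨b, rfl⟩ := hsurj a
      refine Ideal.mem_map_of_mem _ ?_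
      rw [← h]
      exact Ideal.mem_comap.mpr ha
    · rw [Ideal.map_le_iff_le_comap, h]
  letI : LinearOrder (Fin 2 ⊕ Fin m) := LinearOrder.lift' finSumFinEquiv finSumFinEquiv.injective
  rw [hmap, maximalIdeal_mvPowerSeries_eq_span_range_X, Ideal.map_span, ← Set.range_comp]
  rfl

end FormalNodeRing

end DeJong1996

/-! ## 3.3 (split case, closed points) as a named fact -/

/-- NAMED FACT — **de Jong 1996, 3.3 with 2.23 (split case): the complete local ring of a
semi-stable curve at a closed point of `Sing(f)` over a strict normal crossings base.** "2.23. …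
Let `f : X → S` be a semi-stable curve with `S` Noetherian. Consider a point `x ∈ Sing(f)` and
let `s = f(x)`. … Let `B` be the complete local ring of `X` at `x` and let `A` be the complete
local ring of `S` at `s`. … If `f` is a split semi-stable curve … The complete local ring of `X`
at `x` is `B ≅ A⟦u, v⟧/(uv - h)` for some `h ∈ A`." — "3.3. … Suppose that `s` lies in the
components `D₁, …, D_r` of `D` but not in any other component. Let `tᵢ ∈ 𝒪_{S,s}` be an element
such that `V(tᵢ) = Dᵢ ∩ Spec 𝒪_{S,s}`. Note that the elements `t₁, …, t_r` form [part of] a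
regular system of parameters of `𝒪_{S,s}`, hence also of `A` … By assumption [`f` smooth over
`S ∖ D`] we have `V(h) ⊂ V(t₁ ⋯ t_r)`. Therefore we see that `h = ε t₁^{n₁} ⋯ t_r^{n_r}`,
`ε ∈ A^*` with `nᵢ ≥ 0` … We change `Q` into `ε⁻¹Q`. Thus we have
`B ≅ A⟦u, v⟧/(Q - t₁^{n₁} ⋯ t_r^{n_r})` … in the split case we may assume `A = A'` and
`Q(u, v) = uv`" — "4.24. … (Note that there we consider only closed points, so that the
situation is automatically split.)" Rendered for the curve `f : X → Y` of a pair in Situation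
4.23 over an algebraically closed field `k` (`DeJong1996.SemiStablePair f g D τ`: `Y` regular,
`D` a strict normal crossings divisor, `f` semi-stable and smooth over `Y ∖ D`) and a CLOSED
point `x` at which `f` is not smooth (`f` is smooth on no open neighbourhood of `x`, i.e.
`x ∈ Sing(f)`, 2.8), with the complete regular local ring `A = 𝒪̂_{Y,f x}` — residue field `k`,
containing `k` — written as `k⟦T₁, …, T_m⟧` on its regular system of parameters by Cohen's
structure theorem: for every regular system of parameters `t₁, …, t_m` of `𝒪_{Y,f x}`
(`m = dim 𝒪_{Y,f x}`) such that the stalk at `f x` of the ideal of (the reduced structure on)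
`D` is `(t₁ ⋯ t_r)` (the local form 2.4 of the strict normal crossings divisor `D`, whose
branches `t₁, …, t_r` at `f x` are, up to units and order, the printed local equations of the
components `D₁, …, D_r` through `f x`), there are exponents `ν₁, …, ν_m ≥ 0` with `νᵢ = 0` for
`i > r` and a ring isomorphism `𝒪̂_{X,x} ≅ k⟦u, v, T₁, …, T_m⟧/(uv - ∏ Tᵢ^{νᵢ})`
(`DeJong1996.FormalNodeRing k m ν`; `𝒪̂` is Mathlib's `AdicCompletion` at the maximal ideal)
sending the image of `f^#(tᵢ)` to the class of `Tᵢ` for every `i`. (The source gives an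
isomorphism of `A`-algebras; only its effect on the parameters is recorded.) Users take
`(h : DeJong1996SplitNodalStructure)`; it is the node carrying 2.23 (flatness of `B` over `A`,
the nodal closed fibre `B/𝔪_A B ≅ k⟦u, v⟧/(uv)`, and the lifting of the node) and the first half
of 3.3 (the trace `V(u, v)` of `Sing(f)` on `Spec B` lies over `V(h)`, and `Sing(f) ⊆ f⁻¹(D)`).
[cite: DeJong1996, 2.23 and 3.3, pp. 61–63] -/
def DeJong1996SplitNodalStructure : Prop :=
  ∀ (k : Type u) [Field k] [IsAlgClosed k] (X Y : Scheme.{u}) (f : X ⟶ Y)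
    (g : Y ⟶ Spec (.of k)) (D : Set Y) (n : ℕ) (τ : Fin n → (Y ⟶ X))
    (hS : DeJong1996.SemiStablePair f g D τ) (x : X), IsClosed ({x} : Set X) →
      (∀ U : X.Opens, x ∈ U → ¬ Smooth (U.ι ≫ f)) →
        ∀ (m r : ℕ) (t : Fin m → Y.presheaf.stalk (f x)),
          Ideal.span (Set.range t) = maximalIdeal (Y.presheaf.stalk (f x)) →
            ringKrullDim (Y.presheaf.stalk (f x)) = m → r ≤ m →
              stalkIdeal (vanishingIdeal ⟨D, hS.isStrictNormalCrossingsDivisor.isClosed⟩) (f x) =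
                Ideal.span {∏ i ∈ Finset.univ.filter (fun i : Fin m => i.val < r), t i} →
                ∃ (ν : Fin m → ℕ) (e : AdicCompletion (maximalIdeal (X.presheaf.stalk x))
                    (X.presheaf.stalk x) ≃+* DeJong1996.FormalNodeRing k m ν),
                  (∀ i : Fin m, r ≤ i.val → ν i = 0) ∧
                    ∀ i : Fin m, e (algebraMap _ _ ((f.stalkMap x).hom (t i))) =
                      Ideal.Quotient.mk _ (MvPowerSeries.X (Sum.inr i))

/-! ## First consequences -/

namespace DeJong1996.SemiStablePair

variable {k : Type u} [Field k] {X Y : Scheme.{u}} {f : X ⟶ Y} {g : Y ⟶ Spec (.of k)}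
  {D : Set Y} {n : ℕ} {τ : Fin n → (Y ⟶ X)}

/-- A point at which `f` is not smooth lies on no section (the sections of Situation 4.23 map
into the smooth locus of `f`). [cite: DeJong1996, 4.23–4.24, p. 75] -/
theorem notMem_range_of_not_smooth (hS : SemiStablePair f g D τ) {x : X}
    (hx : ∀ U : X.Opens, x ∈ U → ¬ Smooth (U.ι ≫ f)) (i : Fin n) : x ∉ Set.range (τ i) := by
  intro hxi
  obtain ⟨U, hU, hsm⟩ := hS.exists_smooth i
  exact hx U (hU hxi) hsm

/-- A point of the boundary `Z` at which `f` is not smooth lies over `D`. [folklore] -/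
theorem apply_mem_of_not_smooth (hS : SemiStablePair f g D τ) {x : X}
    (hx : ∀ U : X.Opens, x ∈ U → ¬ Smooth (U.ι ≫ f)) (hxZ : x ∈ semiStableBoundary f D τ) :
    f x ∈ D := by
  rcases (mem_semiStableBoundary_iff f D τ x).mp hxZ with ⟨i, hi⟩ | h
  · exact (hS.notMem_range_of_not_smooth hx i hi).elim
  · exact h

/-- At a point at which `f` is not smooth, the stalk of the ideal of the boundary
`Z = ⋃ᵢ τᵢ(Y) ∪ f⁻¹(D)` is the stalk of the ideal of `f⁻¹(D)` (reduced structures), i.e. the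
radical of the extension of the stalk of the ideal of `D`. [folklore] -/
theorem stalkIdeal_semiStableBoundary_of_not_smooth (hS : SemiStablePair f g D τ) {x : X}
    (hx : ∀ U : X.Opens, x ∈ U → ¬ Smooth (U.ι ≫ f)) :
    stalkIdeal (vanishingIdeal ⟨semiStableBoundary f D τ, hS.isClosed_semiStableBoundary⟩) x =
      ((stalkIdeal (vanishingIdeal ⟨D, hS.isStrictNormalCrossingsDivisor.isClosed⟩) (f x)).map
        (f.stalkMap x).hom).radical := by
  have hsecs : (Finset.univ.inf fun j => stalkIdeal (vanishingIdeal
      ⟨Set.range (τ j), (hS.isClosedImmersion j).isClosedEmbedding.isClosed_range⟩) x) = ⊤ := by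
    refine le_antisymm le_top (Finset.le_inf fun j _ => ?_)
    rw [hS.stalkIdeal_vanishingIdeal_range_eq_top j (hS.notMem_range_of_not_smooth hx j)]
  rw [hS.stalkIdeal_vanishingIdeal_semiStableBoundary, hsecs, top_inf_eq,
    stalkIdeal_vanishingIdeal_preimage]

/-- A non-regular point of `X` is a point at which `f` is not smooth (3.1: "the singular locus
`Sing(X)` of the scheme `X` is contained in `Sing(f)`", by EGA IV₄ 17.5.8 (iii), `Y` being
regular). [cite: DeJong1996, 3.1, p. 62] -/
theorem not_smooth_of_not_isRegularLocalRing (hS : SemiStablePair f g D τ) {x : X}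
    (hx : ¬ IsRegularLocalRing (X.presheaf.stalk x)) (U : X.Opens) (hxU : x ∈ U) :
    ¬ Smooth (U.ι ≫ f) := fun hU =>
  hx (hS.isRegularLocalRing_of_smooth hU hxU)

end DeJong1996.SemiStablePair

/-- **Sanity of the exponents**: in the conclusion of `DeJong1996SplitNodalStructure` some
exponent is positive — the completed local ring is nontrivial, while for `ν = 0` the relation
`uv - 1` is a unit and the formal node ring is zero ("`h ∈ 𝔪_A`", 2.23). [folklore] -/
theorem DeJong1996.FormalNodeRing.exists_ne_zero_of_ringEquiv {k : Type u} [Field k] {m : ℕ}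
    {ν : Fin m → ℕ} {R : Type*} [CommRing R] [Nontrivial R]
    (e : R ≃+* DeJong1996.FormalNodeRing k m ν) : ∃ i, ν i ≠ 0 := by
  by_contra h
  push Not at h
  have hunit : IsUnit (DeJong1996.formalNodeRelation k m ν) := by
    rw [MvPowerSeries.isUnit_iff_constantCoeff,
      DeJong1996.FormalNodeRing.constantCoeff_formalNodeRelation, if_pos h]
    exact isUnit_one.neg
  have htop : Ideal.span {DeJong1996.formalNodeRelation k m ν} = ⊤ :=
    (Ideal.span_singleton_eq_top).mpr hunit
  haveI : Subsingleton (DeJong1996.FormalNodeRing k m ν) :=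
    Ideal.Quotient.subsingleton_iff.mpr htop
  exact not_subsingleton R e.toEquiv.subsingleton

end Literature.AlgebraicGeometry.Resolution

end
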